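import Summits.HodgeConjecture.HodgeConjecture.Theorems.NikulinTwinTransportHodgeSimilitudeAlgebraicCmNormDense

/-!
# Route NikulinTwinTransport · crux `TwinTwistorTransport` (stmt-HodgeConjecture-14393) —
# line `ordinary-prime-anchors`, stub `stub_polarisedCmNormPeriod`: polarised CM-norm periods

Stub 2a of the line skeleton `Cruxes/TwinTwistorTransport/Lines/ordinary_prime_anchors.lean`
(registered statement, verbatim):

> for every lattice vector `h ∈ Λ_{K3}` with `h² > 0` there is a point `x₁` of the `h`-polarised
> period domain `D_h` (`x₁² = 0`, `(x̄₁.x₁) > 0`, `h.x₁ = 0`) which is a CM-norm period of multiplier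
> `2` — an eigen-period, with non-real eigenvalue, of a rational `2`-similitude `J` of `(Λ_ℂ, k3Form)`
> with rational two-sided inverse `K`.

This is pure lattice arithmetic on `Λ = E₈(−1)² ⊕ U₁ ⊕ U₂ ⊕ U₃`:
* SEED (`cmNormPeriod_xS`, the proof of `CmNormAnchors.exists_cmNormPeriod` with the witness kept
  explicit): `x₀ = √2 e₂ + √2 f₂ + i e₃ + 2i f₃ ∈ (U₂ ⊕ U₃)_ℂ` is a period point and a CM-norm period of
  multiplier `2` (`J = ¼ JJ`, eigenvalue `−i√2`); it is orthogonal to every vector of `U₁ = ⟨e₁, f₁⟩`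
  (`k3Form_vD_xS`), the Gram matrix being block diagonal.
* ONE REFLECTION: `Λ` is even (`k3Lattice_even`), so `h² = 2d`; `v₀ := e₁ + d f₁ ∈ U₁` has
  `v₀² = 2d = h²` (`vD_sq`). If `(v₀ − h)² ≠ 0` the lattice reflection `s_{v₀−h}` maps `v₀ ↦ h`
  (`reflection_sub_apply_of_sq_eq`); otherwise `(v₀ + h)² = 4h² − (v₀ − h)² ≠ 0` and `s_{v₀+h}` maps
  `v₀ ↦ −h` (`reflection_add_apply_of_sq_eq`) — Iversen's Prop. 2.3.
* `x₁ := s_w x₀` is a period point (`s_w` is a real isometry: `k3Form_k3ReflectionC`,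
  `star_k3ReflectionC`), `h.x₁ = ±(s_w v₀ . s_w x₀) = ±(v₀.x₀) = 0`, and a CM-norm period of the same
  multiplier for `(s_w J s_w, s_w K s_w)` (`CmNormAnchors.cmNormPeriod_prod_k3ReflectionC [w]`).
-/

noncomputable section

set_option linter.dupNamespace false

open scoped Matrix
open Literature.AlgebraicGeometry.Surfaces
open Literature.LinearAlgebra.QuadraticForm

namespace Summit.HodgeConjecture.HodgeConjecture.Theorems.NikulinTwinTransport.OrdinaryPrimeAnchors

open Summit.HodgeConjecture.HodgeConjecture.Theorems.NikulinTwinTransport.CmNormAnchors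

/-! ### Local notations (the line's, bodies verbatim from the skeleton; then the seed's, verbatim from
`Theorems/NikulinTwinTransportHodgeSimilitudeAlgebraicCmNormDense.lean`) -/

/-- `PolPeriod[h, x]`: `x` is a period point polarised by the lattice vector `h` (the points of
`D_h = D ∩ h^⊥`). Local notation only, verbatim from the line skeleton. -/
local notation3 (prettyPrint := false) "PolPeriod[" h ", " x "]" =>
  (k3Form x x = 0 ∧ 0 < (k3Form (star x) x).re ∧ k3Form (fun i => ((h : K3Index → ℤ) i : ℂ)) x = 0)
/-- `RatEnd[J]`: the endomorphism `J` of `Λ_ℂ` is defined over `ℚ`. Local notation only, verbatim from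
the line skeleton. -/
local notation3 (prettyPrint := false) "RatEnd[" J "]" =>
  ∀ v : K3Index → ℤ, ∃ w : K3Index → ℚ, J (fun i => (v i : ℂ)) = fun i => (w i : ℂ)
/-- `CMNormPeriod[c, x]`: `x` is a CM-norm period of multiplier `c`. Local notation only, verbatim from
the line skeleton. -/
local notation3 (prettyPrint := false) "CMNormPeriod[" c ", " x "]" =>
  ∃ (J K : Module.End ℂ (K3Index → ℂ)), RatEnd[J] ∧ RatEnd[K] ∧ J * K = 1 ∧ K * J = 1 ∧
    (∀ a b, k3Form (J a) (J b) = c * k3Form a b) ∧ ∃ t : ℂ, t.im ≠ 0 ∧ J x = t • x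
/-- `E₈ ⊗ ℚ` (as in `k3Gram_map_ratCast`). Local notation only. -/
local notation3 (prettyPrint := false) "E8q" => ((CartanMatrix.E₈).map (Int.cast : ℤ → ℚ) : Matrix (Fin 8) (Fin 8) ℚ)
/-- `diag(1, 16m)` on `U₁` (verbatim from the Lattice toolkit, for `uBlock_conj`). Local notation only. -/
local notation3 (prettyPrint := false) "DU[" m "]" => (!![(1 : ℚ), 0; 0, 16 * m] : Matrix (Fin 2) (Fin 2) ℚ)
/-- The coupling `4C` on `U₂ ⊕ U₃` (`e₂ ↦ 4e₃`, `f₂ ↦ 4m f₃`, `e₃ ↦ −4m e₂`, `f₃ ↦ −4f₂`). Local notation only. -/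
local notation3 (prettyPrint := false) "CC[" m "]" =>
  (Matrix.fromBlocks 0 !![-4 * m, 0; 0, (-4 : ℚ)] !![(4 : ℚ), 0; 0, 4 * m] 0 :
    Matrix (Fin 2 ⊕ Fin 2) (Fin 2 ⊕ Fin 2) ℚ)
/-- `JJ[X, m]`: `E₈`-blocks `X`, `diag(1,16m)` on `U₁`, the coupling on `U₂ ⊕ U₃`. Local notation only. -/
local notation3 (prettyPrint := false) "JJ[" X ", " m "]" =>
  (Matrix.fromBlocks (Matrix.fromBlocks X 0 0 X) 0 0 (Matrix.fromBlocks DU[m] 0 0 CC[m]) :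
    Matrix K3Index K3Index ℚ)
/-- The seed vector `x₀ = s e₂ + s f₂ + i e₃ + i m f₃` (`s = √m`). Local notation only. -/
local notation3 (prettyPrint := false) "xS[" s ", " m "]" =>
  (Sum.elim 0 (Sum.elim 0 (Sum.elim ![((s : ℝ) : ℂ), ((s : ℝ) : ℂ)]
    ![Complex.I, Complex.I * ((m : ℚ) : ℂ)])) : K3Index → ℂ)
/-- The lattice vector `v₀ = e₁ + d f₁ ∈ U₁` of square `2d`. Local notation only. -/
local notation3 (prettyPrint := false) "vD[" d "]" => (Sum.elim 0 (Sum.elim ![1, (d : ℤ)] 0) : K3Index → ℤ)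
/-- `iC[v]`: a lattice vector `v ∈ Λ` viewed in `Λ_ℂ`. Local notation only. -/
local notation3 (prettyPrint := false) "iC[" v "]" => (fun i : K3Index => (((v : K3Index → ℤ) i : ℤ) : ℂ))

/-! ### The seed, with its witness explicit -/

/-- **The seed vector `x₀ = xS[s, n]` (`s = √n`) is a CM-norm period of multiplier `n`**: it is an
eigen-period (eigenvalue `−i√n ∉ ℝ`) of the rational `n`-similitude `J = ¼ JJ` of `(Λ_ℂ, k3Form)` with
rational two-sided inverse `K = J⁻¹` — the statement of `CmNormAnchors.exists_cmNormPeriod` with the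
witness kept explicit. [folklore] -/
theorem cmNormPeriod_xS (n : ℕ) (hn : 0 < n) (s : ℝ) (hs : 0 < s)
    (hsm' : ((n : ℚ) : ℂ) = (s : ℂ) * s) : CMNormPeriod[((n : ℕ) : ℂ), xS[s, (n : ℚ)]] := by
  -- adapted from Theorems/NikulinTwinTransportHodgeSimilitudeAlgebraicCmNormDense `exists_cmNormPeriod`
  obtain ⟨a, b, c, d, habcd⟩ := Nat.sum_four_squares n
  have hm : (a : ℚ) ^ 2 + (b : ℚ) ^ 2 + (c : ℚ) ^ 2 + (d : ℚ) ^ 2 = (n : ℚ) := by exact_mod_cast habcd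
  have hn0 : (n : ℚ) ≠ 0 := by exact_mod_cast hn.ne'
  obtain ⟨X, hX⟩ : ∃ X : Matrix (Fin 8) (Fin 8) ℚ, Xᵀ * E8q * X = (16 * (n : ℚ)) • E8q :=
    ⟨_, e8Block_conj _ _ _ _ _ hm⟩
  set A : Matrix K3Index K3Index ℚ := (4 : ℚ)⁻¹ • JJ[X, (n : ℚ)] with hA
  have hAconj : Aᵀ * k3Gram.map (Int.cast : ℤ → ℚ) * A = (n : ℚ) • k3Gram.map (Int.cast : ℤ → ℚ) := by
    rw [hA, Matrix.transpose_smul, smul_mul_assoc, smul_mul_assoc, mul_smul_comm, jj_conj X _ hX,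
      smul_smul, smul_smul]
    congr 1
    norm_num
    ring
  have hdet : IsUnit A.det := by
    refine isUnit_iff_ne_zero.2 fun h0 => hn0 ?_
    have h := congrArg Matrix.det hAconj
    rw [Matrix.det_mul, Matrix.det_mul, h0, mul_zero, Matrix.det_smul, ← Int.cast_det, k3Gram_det] at h
    simp only [Int.cast_neg, Int.cast_one, mul_neg, mul_one, zero_eq_neg, pow_eq_zero_iff', ne_eq] at h
    exact h.1
  refine ⟨Matrix.toLin' (A.map (Rat.castHom ℂ)), Matrix.toLin' (A⁻¹.map (Rat.castHom ℂ)),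
    fun v => ⟨A *ᵥ fun i => (v i : ℚ), ?_⟩, fun v => ⟨A⁻¹ *ᵥ fun i => (v i : ℚ), ?_⟩, ?_, ?_,
    fun u w => ?_, -(Complex.I * (s : ℂ)), ?_, ?_⟩
  · rw [Matrix.toLin'_apply, intCast_eq_ratCast_intCast, ratCast_map_mulVec]
  · rw [Matrix.toLin'_apply, intCast_eq_ratCast_intCast, ratCast_map_mulVec]
  · rw [Module.End.mul_eq_comp, ← Matrix.toLin'_mul, ← Matrix.map_mul, Matrix.mul_nonsing_inv A hdet,
      Matrix.map_one _ (map_zero _) (map_one _), Matrix.toLin'_one, Module.End.one_eq_id]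
  · rw [Module.End.mul_eq_comp, ← Matrix.toLin'_mul, ← Matrix.map_mul, Matrix.nonsing_inv_mul A hdet,
      Matrix.map_one _ (map_zero _) (map_one _), Matrix.toLin'_one, Module.End.one_eq_id]
  · have hG : k3Gram.map (Int.cast : ℤ → ℂ) = (k3Gram.map (Int.cast : ℤ → ℚ)).map (Rat.castHom ℂ) := by
      rw [Matrix.map_map]
      exact Matrix.ext fun i j => by simp
    have hC : (A.map (Rat.castHom ℂ))ᵀ * k3Gram.map (Int.cast : ℤ → ℂ) * A.map (Rat.castHom ℂ) =
        (n : ℂ) • k3Gram.map (Int.cast : ℤ → ℂ) := by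
      rw [hG, ← Matrix.transpose_map, ← Matrix.map_mul, ← Matrix.map_mul, hAconj,
        Matrix.map_smul' _ _ _ (map_mul (Rat.castHom ℂ)), map_natCast]
    rw [Matrix.toLin'_apply, Matrix.toLin'_apply, k3Form_eq_dotProduct, k3Form_eq_dotProduct,
      ← Matrix.vecMul_transpose (A.map _) u]
    simp only [Matrix.dotProduct_mulVec, Matrix.vecMul_vecMul, hC, Matrix.vecMul_smul,
      smul_dotProduct, smul_eq_mul]
  · simp only [Complex.neg_im, Complex.mul_im, Complex.I_re, Complex.ofReal_im, mul_zero,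
      Complex.I_im, Complex.ofReal_re, one_mul, zero_add]
    exact neg_ne_zero.2 hs.ne'
  · rw [Matrix.toLin'_apply, hA, j_mulVec_xS X _ s hsm']

/-- The seed vector is orthogonal to `U₁ = ⟨e₁, f₁⟩`: `(e₁ + d f₁ . x₀) = 0` (the Gram matrix is block
diagonal and `x₀` is supported on `U₂ ⊕ U₃`). [folklore] -/
theorem k3Form_vD_xS (d : ℤ) (s : ℝ) (m : ℚ) : k3Form iC[vD[d]] xS[s, m] = 0 := by
  simp [k3Form, k3Gram, hyperbolicPlaneGram, Fintype.sum_sum_type, Fin.sum_univ_two]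

/-- `(e₁ + d f₁)² = 2d`. [folklore] -/
theorem vD_sq (d : ℤ) : ∑ i, ∑ j, vD[d] i * k3Gram i j * vD[d] j = d + d := by
  simp [k3Gram, hyperbolicPlaneGram, Fintype.sum_sum_type, Fin.sum_univ_two]

/-! ### Iversen's Prop. 2.3, with the reflecting vector explicit -/

section Reflection

variable {K : Type*} [Field K] [NeZero (2 : K)] {V : Type*} [AddCommGroup V] [Module K V]
  {B : LinearMap.BilinForm K V}

/-- If `⟨e,e⟩ = ⟨f,f⟩` and `e − f` is non-isotropic, the reflection along `e − f` maps `e ↦ f`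
(`2 ≠ 0` in `K`). [cite: Iversen1992, Ch. I §2 Prop. 2.3] -/
theorem reflection_sub_apply_of_sq_eq (hB : B.IsSymm) {e f : V} (hef : B e e = B f f)
    (hm : B (e - f) (e - f) ≠ 0) : reflection B (e - f) e = f := by
  -- adapted from Literature/LinearAlgebra/QuadraticForm/CartanDieudonne `exists_reflections_apply_eq`
  have hfe : B f e = B e f := hB.eq f e
  have hc : 2 / B (e - f) (e - f) * B (e - f) e = 1 := by
    have h2 : B (e - f) (e - f) = 2 * B (e - f) e := by
      simp only [map_sub, LinearMap.sub_apply, hfe]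
      linear_combination hef.symm
    have hne : B (e - f) e ≠ 0 := fun h0 => hm (by rw [h2, h0, mul_zero])
    rw [h2]
    field_simp
  rw [reflection_apply B (e - f) e, hc, one_smul, sub_sub_cancel]

/-- If `⟨e,e⟩ = ⟨f,f⟩` and `e + f` is non-isotropic, the reflection along `e + f` maps `e ↦ −f`
(`2 ≠ 0` in `K`). [cite: Iversen1992, Ch. I §2 Prop. 2.3] -/
theorem reflection_add_apply_of_sq_eq (hB : B.IsSymm) {e f : V} (hef : B e e = B f f)
    (hp : B (e + f) (e + f) ≠ 0) : reflection B (e + f) e = -f := by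
  -- adapted from Literature/LinearAlgebra/QuadraticForm/CartanDieudonne `exists_reflections_apply_eq`
  have hfe : B f e = B e f := hB.eq f e
  have hc : 2 / B (e + f) (e + f) * B (e + f) e = 1 := by
    have h2 : B (e + f) (e + f) = 2 * B (e + f) e := by
      simp only [map_add, LinearMap.add_apply, hfe]
      linear_combination hef.symm
    have hne : B (e + f) e ≠ 0 := fun h0 => hp (by rw [h2, h0, mul_zero])
    rw [h2]
    field_simp
  rw [reflection_apply B (e + f) e, hc, one_smul, show e - (e + f) = -f by abel]

/-- If `⟨e,e⟩ = ⟨f,f⟩ ≠ 0` and `e − f` is isotropic then `e + f` is not: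
`⟨e+f,e+f⟩ + ⟨e−f,e−f⟩ = 4⟨f,f⟩` (`2 ≠ 0` in `K`). [cite: Iversen1992, Ch. I §2 Prop. 2.3] -/
theorem add_sq_ne_zero_of_sub_sq_eq_zero (hB : B.IsSymm) {e f : V}
    (hef : B e e = B f f) (hf : B f f ≠ 0) (hm : B (e - f) (e - f) = 0) : B (e + f) (e + f) ≠ 0 := by
  -- adapted from Literature/LinearAlgebra/QuadraticForm/CartanDieudonne `exists_reflections_apply_eq`
  intro hp
  have hfe : B f e = B e f := hB.eq f e
  have h1 : B (e - f) (e - f) = B e e - 2 * B e f + B f f := by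
    simp only [map_sub, LinearMap.sub_apply, hfe]; ring
  have h2 : B (e + f) (e + f) = B e e + 2 * B e f + B f f := by
    simp only [map_add, LinearMap.add_apply, hfe]; ring
  have h1' : B e e - 2 * B e f + B f f = 0 := h1.symm.trans hm
  have h2' : B e e + 2 * B e f + B f f = 0 := h2.symm.trans hp
  have h3 : (2 * 2 : K) * B f f = 0 := by linear_combination h1' + h2' - 2 * hef
  exact (mul_ne_zero (mul_ne_zero (NeZero.ne 2) (NeZero.ne 2)) hf) h3

end Reflection

/-- **One lattice reflection moves a lattice vector onto `±` any lattice vector of the same non-zero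
square**: for `v, h ∈ Λ` with `v² = h² ≠ 0`, `s_{v−h} v = h` or `s_{v+h} v = −h`.
[cite: Iversen1992, Ch. I §2 Prop. 2.3] -/
theorem exists_k3ReflectionC_apply_eq_or (v h : K3Index → ℤ)
    (hvh : ∑ i, ∑ j, v i * k3Gram i j * v j = ∑ i, ∑ j, h i * k3Gram i j * h j)
    (hh : ∑ i, ∑ j, h i * k3Gram i j * h j ≠ 0) :
    ∃ w : K3Index → ℤ, k3ReflectionC w iC[v] = iC[h] ∨ k3ReflectionC w iC[v] = -iC[h] := by
  have hef : k3FormC iC[v] iC[v] = k3FormC iC[h] iC[h] := by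
    rw [k3FormC_apply, k3FormC_apply, k3Form_intCast, k3Form_intCast, hvh]
  have hf : k3FormC iC[h] iC[h] ≠ 0 := by
    rw [k3FormC_apply, k3Form_intCast]
    exact_mod_cast hh
  have hsub : iC[v - h] = iC[v] - iC[h] := funext fun i => by simp only [Pi.sub_apply, Int.cast_sub]
  have hadd : iC[v + h] = iC[v] + iC[h] := funext fun i => by simp only [Pi.add_apply, Int.cast_add]
  by_cases hm : k3FormC (iC[v] - iC[h]) (iC[v] - iC[h]) = 0
  · refine ⟨v + h, Or.inr ?_⟩
    rw [k3ReflectionC, hadd]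
    exact reflection_add_apply_of_sq_eq k3FormC_isSymm hef
      (add_sq_ne_zero_of_sub_sq_eq_zero k3FormC_isSymm hef hf hm)
  · refine ⟨v - h, Or.inl ?_⟩
    rw [k3ReflectionC, hsub]
    exact reflection_sub_apply_of_sq_eq k3FormC_isSymm hef hm

/-! ### The stub -/

/-- **Stub 2a of line `ordinary-prime-anchors` — polarised CM-norm periods of multiplier `2` exist under
every positive lattice vector** (registered statement of `Cruxes.TwinTwistorTransport.OrdinaryPrimeAnchors`):
for every `h ∈ Λ_{K3}` with `h² > 0` there is `x₁ ∈ D_h` (`x₁² = 0`, `(x̄₁.x₁) > 0`, `h.x₁ = 0`) which is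
an eigen-period, with non-real eigenvalue, of a rational `2`-similitude of `(Λ_ℂ, k3Form)` with rational
two-sided inverse: the seed `x₀ = √2 e₂ + √2 f₂ + i e₃ + 2i f₃ ⊥ U₁` moved by the one lattice reflection
`s_{v₀ ∓ h}`, `v₀ = e₁ + (h²/2) f₁`, that carries `v₀` to `±h`. [folklore] -/
theorem stub_polarisedCmNormPeriod : ∀ (h : K3Index → ℤ), 0 < ∑ i, ∑ j, h i * k3Gram i j * h j →
    ∃ x₁ : K3Index → ℂ, PolPeriod[h, x₁] ∧ CMNormPeriod[(2 : ℂ), x₁] := by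
  intro h hh
  -- `Λ` is even: `h² = 2d`, and `v₀ = e₁ + d f₁` has the same square
  obtain ⟨d, hd⟩ := k3Lattice_even h
  -- the seed `x₀ = xS[√2, 2]`
  set s : ℝ := Real.sqrt 2 with hs_def
  have hs : 0 < s := Real.sqrt_pos.2 two_pos
  have hsm' : (((2 : ℕ) : ℚ) : ℂ) = (s : ℂ) * s := by
    rw [← Complex.ofReal_mul, hs_def, Real.mul_self_sqrt zero_le_two]
    simp
  have hcm := cmNormPeriod_xS 2 two_pos s hs hsm'
  rw [Nat.cast_ofNat] at hcm
  obtain ⟨hxx, hpos, -, -⟩ := xS_period ((2 : ℕ) : ℚ) s hs hsm'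
  have horth := k3Form_vD_xS d s ((2 : ℕ) : ℚ)
  -- one lattice reflection `s_w` with `s_w v₀ = ± h`
  obtain ⟨w, hw⟩ := exists_k3ReflectionC_apply_eq_or vD[d] h (by rw [vD_sq, hd]) hh.ne'
  refine ⟨k3ReflectionC w xS[s, ((2 : ℕ) : ℚ)], ⟨?_, ?_, ?_⟩, ?_⟩
  · rw [k3Form_k3ReflectionC]
    exact hxx
  · rw [star_k3ReflectionC, k3Form_k3ReflectionC]
    exact hpos
  · rcases hw with hw | hw
    · rw [← hw, k3Form_k3ReflectionC, horth]
    · have hneg : iC[h] = -k3ReflectionC w iC[vD[d]] := by rw [hw, neg_neg]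
      rw [hneg, ← k3FormC_apply, map_neg, LinearMap.neg_apply, k3FormC_apply, k3Form_k3ReflectionC,
        horth, neg_zero]
  · have hl : ([w].map k3ReflectionC).prod = k3ReflectionC w := by simp
    have hx₁ := cmNormPeriod_prod_k3ReflectionC [w] hcm
    rwa [hl] at hx₁

end Summit.HodgeConjecture.HodgeConjecture.Theorems.NikulinTwinTransport.OrdinaryPrimeAnchors

end
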